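import Summits.HubbardSuperconductivity.HubbardSuperconductivity.Theorems.TwTipContinuation.Negative.TipNormalForm
import Summits.HubbardSuperconductivity.HubbardSuperconductivity.Theorems.BalabanIRBirEveryGroundStateMoments

/-!
# `TwTipContinuation` (stmt-HubbardSuperconductivity-1700) — line `ground-space-second-moment`, lead skeleton (2nd lead)

Crux (route `ThermalWedge`, rank 6): `Summit.HubbardSuperconductivity.HubbardSuperconductivity.Theses.ThermalWedge.TwTipContinuation`.
By `twTipContinuation_of_uniformSummit` (Theorems/TwTipContinuation/Negative/TipNormalForm.lean) it suffices to produce, at ONE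
`δ ∈ [1/10,2/5]` and for ALL `U ∈ (0,U₁]`, the summit's matrix at `(U,δ)` (every admissible normalised sector ground-state
sequence of the PURE torus `hubbardTorus 2 L 1 U` has d-wave pair-field LRO along even sides); the RUNG antecedent of the
crux is discarded (Disproof §1/§5: it is idle).

Line (card `Cruxes/TwTipContinuation/Ideas/ground-space-second-moment.md`; lever LANDED as
`forall_unit_le_re_of_moments` / `hasLRO_of_groundState_moments`, Theorems/BalabanIRBirEveryGroundStateMoments.lean).
Notation at side `L`, coupling `U`, doping `δ`: `N_L = 2⌊(1-δ)L²/2⌋`, `S = szSector N_L 0`, `H = hubbardTorus 2 L 1 U`,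
`E₀ = S ⊓ ker(H − minEnergyOn H S)` (the sector ground eigenspace), `P = projMatrix (E₀.map (WithLp.linearEquiv 2 ℂ _).symm)` (its orthogonal
projection transported to `EuclideanSpace` — literally the `Fock.toEuclidean` of `hasLRO_of_groundState_moments`, `map_toEuclidean_eq`; `re tr P = dim E₀ ≥ 1`), `O = P_L = (pairField d L)ᴴ (pairField d L)`. Three stubs, all on the
B1g part `δ ∈ [1/10,3/10]` of the window (Disproof §15 SHARPEN: the edge `δ = 2/5` sits at the `U → 0` p′/d_xy region):
* `stub_groundAverageOrder`        (T1, hardest, the lead's) — ∃δ ∃U₁ ∀U ≤ U₁ ∃a(U) > 0: eventually in even `L`,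
  the ground-space AVERAGE of the pair intensity is `≥ a L⁴`:  `a L⁴ · re tr P ≤ re tr (P O)`;
* `stub_groundCompressionVariance` (T2) — ∀δ ∃U₁ ∀U ≤ U₁ ∀η > 0: eventually the tracial VARIANCE of the compression
  `P O P` is `≤ η L⁸`:  `re tr (P O P O) · re tr P − (re tr (P O))² ≤ η L⁸ (re tr P)²`;
* `stub_groundDegeneracyBounded`   (T3) — ∀δ ∃U₁ ∀U ≤ U₁ ∃D(U): eventually `re tr P ≤ D` (bounded ground degeneracy).
Composition `TwTipContinuation_of`: at the δ of T1 and `U ≤ min U₁ U₂ U₃`: T1 gives `(re tr PO)² ≥ a²L⁸(re tr P)²`, so T2 with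
`η := a²/(4D')` (`D' = max D 1`) gives the lever's second-moment clause `re tr(POPO)·re tr P ≤ (1 + 1/(4D'))(re tr PO)²` with
`ε D' = 1/4`; `hasLRO_of_groundState_moments` ⇒ summit matrix at `(U,δ)` ⇒ `twTipContinuation_of_uniformSummit`.
Disproof §12: T2 and T3 are each load-bearing for THIS lever (abstract witnesses `not_pinning_without_spread`,
`not_pinning_without_degeneracyBound`), hence kept as separate registered stubs. No U-uniform constant is asserted anywhere
(weak-coupling darkness, Theorems/ThermalWedgeTwTipContinuationWeakCouplingDarkness.lean: `a(U) ≤ 256 U^{1/3}` is forced).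

All statements are on LITERAL tree terms (no local abbreviation), so that each stub lands verbatim as a `--supports` helper.
-/

noncomputable section

namespace Summit.HubbardSuperconductivity.TwTipContinuation.GroundSpaceMoments

open Matrix Filter Finset
open Literature.MathematicalPhysics.QuantumLattice Literature.Probability.LatticeModels
open Summit.HubbardSuperconductivity.HubbardSuperconductivity.Theses.ThermalWedge
open Summit.HubbardSuperconductivity.TwTipContinuation.Negative
open Summit.HubbardSuperconductivity.HubbardSuperconductivity.Theorems
open scoped ComplexOrder

/-! ### The three registered stubs -/

/-- STUB T1 (XL, crux-sized — held by the line lead): **ground-space AVERAGE d-wave order of the pure torus at weak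
coupling.** At one doping of the B1g window there is `U₁ > 0` such that for every `U ∈ (0,U₁]` some `a > 0` bounds,
eventually in even `L`, the tracial ground-space average of the pair intensity from below: `a L⁴ · re tr P ≤ re tr (P P_L)`.
(The `β → ∞`-then-`L → ∞` sector Gibbs expectation of `P_L`; implies the ∃-ground-state weak-coupling d-wave order window —
Kohn–Luttinger pairing as a theorem; NOT an every-ground-state statement.) Kohn–Luttinger 1965; Raghu–Kivelson–Scalapino
2010 §III; Scalapino, Phys. Rep. 250 (1995) §2. [folklore] -/
theorem stub_groundAverageOrder :
    ∃ δ ∈ Set.Icc (1 / 10 : ℝ) (3 / 10), ∃ U₁ : ℝ, 0 < U₁ ∧ ∀ U ∈ Set.Ioc (0 : ℝ) U₁, ∃ a : ℝ, 0 < a ∧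
      ∃ L₀ : ℕ, ∀ (L : ℕ) [NeZero L], L₀ ≤ L → Even L →
        a * (L : ℝ) ^ 4 *
            (projMatrix (((szSector (2 * ⌊(1 - δ) * (L : ℝ) ^ 2 / 2⌋₊) 0 : Submodule ℂ (Fock (Orb (FermionTorus 2 L)))) ⊓
                Module.End.eigenspace (Matrix.toLin' (hubbardTorus 2 L 1 U))
                  (((hubbardTorus 2 L 1 U).minEnergyOn (szSector (2 * ⌊(1 - δ) * (L : ℝ) ^ 2 / 2⌋₊) 0) : ℝ) : ℂ)).map
              ((WithLp.linearEquiv 2 ℂ (Finset (Orb (FermionTorus 2 L)) → ℂ)).symm :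
                (Finset (Orb (FermionTorus 2 L)) → ℂ) →ₗ[ℂ] EuclideanSpace ℂ (Finset (Orb (FermionTorus 2 L)))))).trace.re ≤
          (projMatrix (((szSector (2 * ⌊(1 - δ) * (L : ℝ) ^ 2 / 2⌋₊) 0 : Submodule ℂ (Fock (Orb (FermionTorus 2 L)))) ⊓
                Module.End.eigenspace (Matrix.toLin' (hubbardTorus 2 L 1 U))
                  (((hubbardTorus 2 L 1 U).minEnergyOn (szSector (2 * ⌊(1 - δ) * (L : ℝ) ^ 2 / 2⌋₊) 0) : ℝ) : ℂ)).map
              ((WithLp.linearEquiv 2 ℂ (Finset (Orb (FermionTorus 2 L)) → ℂ)).symm :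
                (Finset (Orb (FermionTorus 2 L)) → ℂ) →ₗ[ℂ] EuclideanSpace ℂ (Finset (Orb (FermionTorus 2 L))))) *
            ((pairField dWaveFormFactor L)ᴴ * pairField dWaveFormFactor L)).trace.re := by
  sorry

/-- STUB T2 (L): **vanishing tracial variance of the ground compression of the pair intensity.** For every doping of the
B1g window there is `U₁ > 0` such that for all `U ∈ (0,U₁]` and `η > 0`, eventually in even `L`,
`re tr (P P_L P P_L) · re tr P − (re tr (P P_L))² ≤ η L⁸ (re tr P)²` (the variance of the eigenvalues of `P P_L P` on `E₀`,
normalised by `L⁸`, tends to `0`; physically `≍ log L / L²`; an intruder level exactly degenerate with the condensate would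
make it `O(1)`). Scalapino, Phys. Rep. 250 (1995) §2; Tasaki 2020 App. A.2. [folklore] -/
theorem stub_groundCompressionVariance :
    ∀ δ ∈ Set.Icc (1 / 10 : ℝ) (3 / 10), ∃ U₁ : ℝ, 0 < U₁ ∧ ∀ U ∈ Set.Ioc (0 : ℝ) U₁, ∀ η : ℝ, 0 < η →
      ∃ L₀ : ℕ, ∀ (L : ℕ) [NeZero L], L₀ ≤ L → Even L →
        (projMatrix (((szSector (2 * ⌊(1 - δ) * (L : ℝ) ^ 2 / 2⌋₊) 0 : Submodule ℂ (Fock (Orb (FermionTorus 2 L)))) ⊓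
                Module.End.eigenspace (Matrix.toLin' (hubbardTorus 2 L 1 U))
                  (((hubbardTorus 2 L 1 U).minEnergyOn (szSector (2 * ⌊(1 - δ) * (L : ℝ) ^ 2 / 2⌋₊) 0) : ℝ) : ℂ)).map
              ((WithLp.linearEquiv 2 ℂ (Finset (Orb (FermionTorus 2 L)) → ℂ)).symm :
                (Finset (Orb (FermionTorus 2 L)) → ℂ) →ₗ[ℂ] EuclideanSpace ℂ (Finset (Orb (FermionTorus 2 L))))) *
            ((pairField dWaveFormFactor L)ᴴ * pairField dWaveFormFactor L) *
          projMatrix (((szSector (2 * ⌊(1 - δ) * (L : ℝ) ^ 2 / 2⌋₊) 0 : Submodule ℂ (Fock (Orb (FermionTorus 2 L)))) ⊓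
                Module.End.eigenspace (Matrix.toLin' (hubbardTorus 2 L 1 U))
                  (((hubbardTorus 2 L 1 U).minEnergyOn (szSector (2 * ⌊(1 - δ) * (L : ℝ) ^ 2 / 2⌋₊) 0) : ℝ) : ℂ)).map
              ((WithLp.linearEquiv 2 ℂ (Finset (Orb (FermionTorus 2 L)) → ℂ)).symm :
                (Finset (Orb (FermionTorus 2 L)) → ℂ) →ₗ[ℂ] EuclideanSpace ℂ (Finset (Orb (FermionTorus 2 L))))) *
            ((pairField dWaveFormFactor L)ᴴ * pairField dWaveFormFactor L)).trace.re *
          (projMatrix (((szSector (2 * ⌊(1 - δ) * (L : ℝ) ^ 2 / 2⌋₊) 0 : Submodule ℂ (Fock (Orb (FermionTorus 2 L)))) ⊓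
                Module.End.eigenspace (Matrix.toLin' (hubbardTorus 2 L 1 U))
                  (((hubbardTorus 2 L 1 U).minEnergyOn (szSector (2 * ⌊(1 - δ) * (L : ℝ) ^ 2 / 2⌋₊) 0) : ℝ) : ℂ)).map
              ((WithLp.linearEquiv 2 ℂ (Finset (Orb (FermionTorus 2 L)) → ℂ)).symm :
                (Finset (Orb (FermionTorus 2 L)) → ℂ) →ₗ[ℂ] EuclideanSpace ℂ (Finset (Orb (FermionTorus 2 L)))))).trace.re -
          (projMatrix (((szSector (2 * ⌊(1 - δ) * (L : ℝ) ^ 2 / 2⌋₊) 0 : Submodule ℂ (Fock (Orb (FermionTorus 2 L)))) ⊓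
                Module.End.eigenspace (Matrix.toLin' (hubbardTorus 2 L 1 U))
                  (((hubbardTorus 2 L 1 U).minEnergyOn (szSector (2 * ⌊(1 - δ) * (L : ℝ) ^ 2 / 2⌋₊) 0) : ℝ) : ℂ)).map
              ((WithLp.linearEquiv 2 ℂ (Finset (Orb (FermionTorus 2 L)) → ℂ)).symm :
                (Finset (Orb (FermionTorus 2 L)) → ℂ) →ₗ[ℂ] EuclideanSpace ℂ (Finset (Orb (FermionTorus 2 L))))) *
            ((pairField dWaveFormFactor L)ᴴ * pairField dWaveFormFactor L)).trace.re ^ 2 ≤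
        η * (L : ℝ) ^ 8 *
          (projMatrix (((szSector (2 * ⌊(1 - δ) * (L : ℝ) ^ 2 / 2⌋₊) 0 : Submodule ℂ (Fock (Orb (FermionTorus 2 L)))) ⊓
                Module.End.eigenspace (Matrix.toLin' (hubbardTorus 2 L 1 U))
                  (((hubbardTorus 2 L 1 U).minEnergyOn (szSector (2 * ⌊(1 - δ) * (L : ℝ) ^ 2 / 2⌋₊) 0) : ℝ) : ℂ)).map
              ((WithLp.linearEquiv 2 ℂ (Finset (Orb (FermionTorus 2 L)) → ℂ)).symm :
                (Finset (Orb (FermionTorus 2 L)) → ℂ) →ₗ[ℂ] EuclideanSpace ℂ (Finset (Orb (FermionTorus 2 L)))))).trace.re ^ 2 := by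
  sorry

/-- STUB T3 (L): **bounded ground degeneracy in the summit's sector at weak coupling.** For every doping of the B1g window
there is `U₁ > 0` such that for all `U ∈ (0,U₁]` some `D` bounds, eventually in even `L`, the dimension of the sector ground
eigenspace: `re tr P ≤ D`. (A spectral bet carrying no information about order; consistent with Anderson towers, which live
in the sectors `N_L ± 2`.) Tasaki 2020 §2.2. [folklore] -/
theorem stub_groundDegeneracyBounded :
    ∀ δ ∈ Set.Icc (1 / 10 : ℝ) (3 / 10), ∃ U₁ : ℝ, 0 < U₁ ∧ ∀ U ∈ Set.Ioc (0 : ℝ) U₁, ∃ D : ℝ,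
      ∃ L₀ : ℕ, ∀ (L : ℕ) [NeZero L], L₀ ≤ L → Even L →
        (projMatrix (((szSector (2 * ⌊(1 - δ) * (L : ℝ) ^ 2 / 2⌋₊) 0 : Submodule ℂ (Fock (Orb (FermionTorus 2 L)))) ⊓
                Module.End.eigenspace (Matrix.toLin' (hubbardTorus 2 L 1 U))
                  (((hubbardTorus 2 L 1 U).minEnergyOn (szSector (2 * ⌊(1 - δ) * (L : ℝ) ^ 2 / 2⌋₊) 0) : ℝ) : ℂ)).map
              ((WithLp.linearEquiv 2 ℂ (Finset (Orb (FermionTorus 2 L)) → ℂ)).symm :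
                (Finset (Orb (FermionTorus 2 L)) → ℂ) →ₗ[ℂ] EuclideanSpace ℂ (Finset (Orb (FermionTorus 2 L)))))).trace.re ≤ D := by
  sorry

/-! ### Composition (sorry-free modulo the three stubs) -/

/-- Arithmetic of the composition: from the average clause `a X · p ≤ m` (`a, X > 0`, `p ≥ 0`), the variance clause
`T p − m² ≤ η X² p²` with `η = a² / (4 D')` and `0 < D'`, one gets the lever's relative second-moment clause
`T p ≤ (1 + 1/(4 D')) m²`. [folklore] -/
theorem relMoment_of_variance {a X p m T η D' : ℝ} (ha : 0 < a) (hX : 0 < X) (hp : 0 ≤ p) (hD' : 0 < D')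
    (havg : a * X * p ≤ m) (hvar : T * p - m ^ 2 ≤ η * X ^ 2 * p ^ 2) (hη : η = a ^ 2 / (4 * D')) :
    T * p ≤ (1 + 1 / (4 * D')) * m ^ 2 := by
  have h0 : 0 ≤ a * X * p := by positivity
  have hm : 0 ≤ m := h0.trans havg
  have hsq : (a * X * p) ^ 2 ≤ m ^ 2 := pow_le_pow_left₀ h0 havg 2
  have hkey : η * X ^ 2 * p ^ 2 ≤ 1 / (4 * D') * m ^ 2 := by
    rw [hη]
    have : a ^ 2 / (4 * D') * X ^ 2 * p ^ 2 = 1 / (4 * D') * (a * X * p) ^ 2 := by ring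
    rw [this]
    exact mul_le_mul_of_nonneg_left hsq (by positivity)
  nlinarith

/-- **The line's composition**: the three stubs give `TwTipContinuation` (entry through `twTipContinuation_of_uniformSummit`
and the landed lever `hasLRO_of_groundState_moments`; the RUNG antecedent is unused). [folklore] -/
theorem TwTipContinuation_of : TwTipContinuation := by
  obtain ⟨δ, hδ3, U₁, hU₁, hT1⟩ := stub_groundAverageOrder
  obtain ⟨U₂, hU₂, hT2⟩ := stub_groundCompressionVariance δ hδ3
  obtain ⟨U₃, hU₃, hT3⟩ := stub_groundDegeneracyBounded δ hδ3
  have hδ : δ ∈ Set.Icc (1 / 10 : ℝ) (2 / 5) := ⟨hδ3.1, hδ3.2.trans (by norm_num)⟩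
  have hδ' : (-1 : ℝ) ≤ δ := by linarith [hδ.1]
  refine twTipContinuation_of_uniformSummit
    ⟨min U₁ (min U₂ U₃), lt_min hU₁ (lt_min hU₂ hU₃), δ, hδ, fun U hU => ?_⟩
  have hU1 : U ∈ Set.Ioc (0 : ℝ) U₁ := ⟨hU.1, hU.2.trans (min_le_left _ _)⟩
  have hU2 : U ∈ Set.Ioc (0 : ℝ) U₂ := ⟨hU.1, hU.2.trans ((min_le_right _ _).trans (min_le_left _ _))⟩
  have hU3 : U ∈ Set.Ioc (0 : ℝ) U₃ := ⟨hU.1, hU.2.trans ((min_le_right _ _).trans (min_le_right _ _))⟩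
  obtain ⟨a, ha, L₁, h1⟩ := hT1 U hU1
  obtain ⟨D, L₃, h3⟩ := hT3 U hU3
  set D' : ℝ := max D 1 with hD'
  have hD'pos : 0 < D' := lt_of_lt_of_le one_pos (le_max_right _ _)
  obtain ⟨L₂, h2⟩ := hT2 U hU2 (a ^ 2 / (4 * D')) (by positivity)
  intro N ψ hadm
  refine hasLRO_of_groundState_moments U δ a (1 / (4 * D')) D' hδ' ha (by positivity)
    (le_of_eq (by field_simp)) (max L₁ (max L₂ L₃)) (fun L _ hL hEv => ?_) N ψ hadm
  have hL₁ : L₁ ≤ L := le_trans (le_max_left _ _) hL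
  have hL₂ : L₂ ≤ L := le_trans ((le_max_left _ _).trans (le_max_right _ _)) hL
  have hL₃ : L₃ ≤ L := le_trans ((le_max_right _ _).trans (le_max_right _ _)) hL
  have havg := h1 L hL₁ hEv
  have hvar := h2 L hL₂ hEv
  have hdeg := h3 L hL₃ hEv
  intro NL H S E₀ P O
  have hp : 0 ≤ P.trace.re := by
    -- `re tr P ≥ 0`: it is the dimension of `E₀`
    show 0 ≤ (projMatrix (E₀.map (Fock.toEuclidean (ι := Orb (FermionTorus 2 L)) :
      Fock (Orb (FermionTorus 2 L)) →ₗ[ℂ] EuclideanSpace ℂ (Finset (Orb (FermionTorus 2 L)))))).trace.re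
    rw [map_toEuclidean_eq, trace_projMatrix_map]
    simp
  have hX : (0 : ℝ) < (L : ℝ) ^ 4 := by
    have := NeZero.pos L
    positivity
  refine ⟨havg, ?_, hdeg.trans (le_max_left _ _)⟩
  have hvar' : (P * O * P * O).trace.re * P.trace.re - (P * O).trace.re ^ 2 ≤
      a ^ 2 / (4 * D') * ((L : ℝ) ^ 4) ^ 2 * P.trace.re ^ 2 := by
    have : ((L : ℝ) ^ 4) ^ 2 = (L : ℝ) ^ 8 := by ring
    rw [this]
    exact hvar
  exact relMoment_of_variance ha hX hp hD'pos havg hvar' rfl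

end Summit.HubbardSuperconductivity.TwTipContinuation.GroundSpaceMoments

end
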